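import Literature.MathematicalPhysics.QuantumLattice.HubbardTTPrimeEquilibriumStatesNoPairing
import Literature.MathematicalPhysics.QuantumLattice.HubbardPeriodicEquilibriumStatesNoMagneticOrder
import HarnessLib

/-!
# Barrier: no `U(1)` symmetry breaking — no pairing amplitude — in ANY translation-invariant or periodic equilibrium state of the 2D
# `t–t'` Hubbard model at any temperature; at zero field no magnetisation either (Klein–Landau–Shucker 1981 / Koma–Tasaki 1992 /
# Ghosh 1971; proved, infinite volume)

Barrier catalogue `Literature/Barriers/HubbardSuperconductivity/` (D-0021), entry `EquilibriumStatesNoU1Breaking2D`, for the summit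
`HubbardSuperconductivity`. Companion of the finite-volume entries `PositiveTemperatureNoPairLRO` (Koma–Tasaki: power-law decay of the
pair two-point function of the torus Gibbs states) and `HohenbergMerminWagnerPairing` (the bond / `d`-wave pair field): those constrain
TWO-POINT functions of finite-volume GIBBS states; the present entry constrains the ONE-POINT function (the order parameter itself) of
EVERY translation-invariant EQUILIBRIUM STATE OF THE INFINITE SYSTEM — including any putative symmetry-broken state that is not a
limit of symmetric Gibbs states. Everything is PROVED in the tree (`HubbardTTPrimeEquilibriumStatesNoPairing`, via
`VariationalPrincipleLocalKMSRows` → `VariationalPrincipleBogoliubovInequality` → `MerminWagnerCriterionEquilibriumStates` →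
`MerminWagnerEquilibriumStates2D`); this file assembles the headline and records the BARRIER block.

**Extension (2026-08-28, v2 of the block; the Prop `EquilibriumStatesNoU1Breaking2D` is unchanged):** the same conclusions now hold,
as theorems of the tree, for every **`q`-PERIODIC equilibrium state of every period** (`InfVolFermionState.IsPerVarEquilibrium`,
`PeriodicEquilibriumStatesPerturbationRows` → `MerminWagnerPeriodicEquilibriumStates`: no pair-density-wave or spiral one-point order) and,
at zero Zeeman field, for the full **`SU(2)`** spin symmetry (`HubbardPeriodicEquilibriumStatesNoMagneticOrder`: `ω(S^z_x) = ω(S^±_x) = 0` at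
every site and `staggeredMagnetisation ω = 0` for every periodic equilibrium state — Ghosh 1971 in the Klein–Landau–Shucker form); the
corollaries `EquilibriumStatesNoU1Breaking2D.periodic_pairAmplitude_eq_zero` / `…periodic_sZ_eq_zero` /
`…periodic_staggeredMagnetisation_eq_zero` below record them next to the entry.

## Sources (as printed)

* A. Klein, L. J. Landau, D. S. Shucker, *On the absence of spontaneous breakdown of continuous symmetry for equilibrium states in two
  dimensions*, J. Stat. Phys. 26 (1981) 505–512 (`KleinLandauShucker1981`; not held — title claim: equilibrium (KMS) states of
  two-dimensional quantum systems with a continuous symmetry do not break it; method: Bogoliubov's inequality for KMS states).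
* T. Koma, H. Tasaki, PRL 68 (1992) 3248 (`KomaTasakiPRL1992`, held as `paper:arxiv-cond-mat_9709068`), p. 3: "by combining the
  Mermin-Wagner argument with the idea to make use of the quantum mechanical `U(1)` symmetry, one can also prove the absence of
  condensation of electron pairs"; "our method can be easily extended to rule out any kind of condensation which is related to a
  spontaneous breakdown of the quantum mechanical global `U(1)` symmetry" (for finite-volume Gibbs states).
* H. Araki, H. Moriya, Rev. Math. Phys. 15 (2003) 93 (`ArakiMoriya2003`, held as `paper:arxiv-math-ph_0211016`, pp. 43–45), Thm. 12.11:
  a translation-invariant solution of the variational principle is a dKMS state (the infinite-volume equilibrium notion used here: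
  `InfVolFermionState.IsVarEquilibrium`, maximisers of `s − βe` = tangent functionals of the pressure).

## Lean rendering

`EquilibriumStatesNoU1Breaking2D`: for all real `t, t', U, μ, h`, every `β ≥ 0` and every translation-invariant equilibrium state
`ω` of the grand-canonical `t–t'` Hubbard interaction on `ℤ²` (`ω.IsVarEquilibrium β (gcInteractionTT' t t' U μ h) 1`):
(1) `ω(O) = 0` for every local `O ∈ 𝔄_Λ` of nonzero particle number (`N_Λ O − O N_Λ = κO`, `κ ≠ 0`); (2) `ω(O) = 0` for every local
`O` of nonzero spin imbalance (`(N↑_Λ − N↓_Λ)O − O(N↑_Λ − N↓_Λ) = κO`, `κ ≠ 0`); (3) every pair amplitude vanishes, `ω(c_p c_q) = 0`.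
PROVED (`EquilibriumStatesNoU1Breaking2D_holds`).

technique_class: order-parameter-in-a-translation-invariant-or-periodic-equilibrium-state symmetry-broken-TI-or-periodic-KMS-state anomalous-average-⟨cc⟩≠0 pair-density-wave-amplitude quasi-average-Bogoliubov-⟨Δ⟩ mean-field-or-variational-state-with-pairing-amplitude-read-as-equilibrium transverse-magnetisation Néel-or-stripe-magnetisation-at-zero-field (explicitly and only: the expectation, in a translation-invariant maximiser of `s − βe` or a `q`-periodic maximiser of `s̄ − βē_q` (any period `q`) for the 2D `t–t'` Hubbard interaction at a fixed `β < ∞`, of a strictly local observable carrying nonzero particle number or nonzero spin imbalance, and at `h = 0` of a local observable charged under the spin flip `S⁺ + S⁻`, e.g. `S^z_x`)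
blocks: every route to (a positive-temperature strengthening of) `HubbardSuperconductivity` whose certificate is a nonzero superconducting order parameter `ω(c_{x↑}c_{y↓})`, `ω(Δ_d)`, or any `U(1)`-charged one-point function, or a transverse magnetisation `ω(S^±_x)`, of a translation-invariant OR PERIODIC (any period: pair-density waves, spirals) equilibrium state of the two-dimensional model at `T > 0`, and at `h = 0` every route certifying Néel / stripe / ferri- or ferromagnetic order by a nonzero `ω(S^z_x)` or a nonzero staggered magnetisation of a periodic equilibrium state at `T > 0` — such states do not exist [cite: KleinLandauShucker1981] [cite: KomaTasakiPRL1992, p. 3] [cite: Ghosh1971]; in particular a translation-invariant BCS / Gutzwiller / tensor-network state with `⟨cc⟩ ≠ 0` is never an equilibrium state of the 2D model at any `β < ∞`, and "spontaneous `U(1)` breaking at `T_c > 0`" in the strict sense is false in `d = 2` for translation-invariant states (tree: `InfVolFermionState.IsVarEquilibrium.expect_annihilation_mul_annihilation_eq_zero_ttPrime`).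
because: a translation-invariant solution of the variational principle satisfies the energy–entropy-balance rows and hence Bogoliubov's inequality `|ω([C̃,Ã])|² ≤ ½β ω(ÃÃᴴ+ÃᴴÃ) ω([C̃ᴴ,[H_{Λ'},C̃]])` for all local `A, C` [cite: ArakiMoriya2003, Theorem 12.11] [cite: DLS1978, §2 eq. (28)] (tree: `IsVarEquilibrium.bogoliubov_inequality`, by a pressure-perturbation argument); with `C = Σ_x f(x) q_x` the smeared conserved charge (`f ≡ 1` on `supp O`), `[C, Õ] = κÕ` exactly while `‖[C,[H,C]]‖ ≤ 4‖q‖² Σ_Z ‖Φ(Z)‖ (osc_Z f)²` because every interaction term conserves the charge [cite: KleinLandauShucker1981] (tree: `norm_doubleCommutator_weightedCharge_localHamiltonian_le`); in `d = 2` the logarithmic cutoff has Dirichlet sum `≲ 32⌊R⌋²(1 + log(ae^M))/M² → 0` (tree: `sum_box_logCutoffModulus_sq_le`, `exists_logCutoff_data`), forcing `|κ|²|ω(O)|² ≤ β‖O‖²ε` for every `ε > 0`.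
evasions_known: (i) `T = 0`: ground states (`β = ∞`) are not maximisers of `s − βe` at any finite `β` and are unconstrained — Néel order of the 2D Heisenberg antiferromagnet at `T = 0` is the standard example, and the summit `HubbardSuperconductivity` is posed for ground states [cite: KomaTasakiPRL1992, p. 3 ("the power indices … are proportional to `β⁻¹`")]; (ii) quasi-long-range (Berezinskii–Kosterlitz–Thouless) order: power-law pair correlations and a positive helicity modulus at `0 < T < T_BKT` involve no nonzero one-point function and are untouched [cite: KomaTasakiPRL1992, p. 3 ("the slowest possible decay … is of the Kosterlitz-Thouless type")] [cite: PaivaEtAl2004, pp. 2–4]; (iii) `d = 3` or interlayer coupling: outside the hypothesis `ℤ²` (the Dirichlet sum no longer tends to `0`) [cite: KleinLandauShucker1981] — QUANTIFIED in the tree: for a charge-conserving finite-range interaction on `ℤ³` with interlayer coupling norm `ε_⊥` every translation-invariant equilibrium state obeys `|κ|²|ω(O)|² ≤ β‖O‖²·4‖q‖²|box ⌊R⌋|(2ρ₀+1)[S_Ψ·32⌊R⌋²(1+log(N+ρ₀+⌊R⌋))/M² + ε_⊥(2N+1)²]` for all `M > 0`, `N ≥ a e^M` (`Literature.MathematicalPhysics.QuantumLattice.InfVolFermionState.IsVarEquilibrium.norm_sq_expect_le_layered`),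 i.e. `|ω(O)|² = O(β/log(1/ε_⊥))`; for the stacked `t–t'–t_⊥` Hubbard model `ε_⊥ ≤ 4|t_⊥|` and `4|ω(c_p c_q)|² ≤ β·(same bracket)` (`…IsVarEquilibrium.norm_sq_expect_pair_le_stacked`): a pairing amplitude `m₀` in weakly coupled layers needs `β ≳ m₀² log(1/|t_⊥|)` — interlayer coupling evades the `ω(O) = 0` conclusion only logarithmically slowly [cite: KleinLandauShucker1981]; (iv) discrete symmetries / charge-neutral composite (vestigial) orders are not generated by a continuous on-site charge and may order at `T > 0` in `d = 2` [cite: FernandesOrthSchmalian2019, arXiv pp. 8 and 10]; none of (i)–(iv) produces a `U(1)`-breaking equilibrium state at `T > 0` in `d = 2`.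
scope_caveats: translation-invariant AND periodic equilibrium states (every period `q`; tree: `InfVolFermionState.IsPerVarEquilibrium.expect_eq_zero_of_conservedCharge_two`, `…expect_annihilation_mul_annihilation_eq_zero_ttPrime`, `…expect_sZAt_eq_zero_ttPrime`, `…staggeredMagnetisation_eq_zero_ttPrime`) — NON-periodic KMS states (e.g. with a single domain wall), which [cite: KleinLandauShucker1981] also covers (title claim: "equilibrium states"), are still outside the tree's equilibrium notions; ONE-POINT functions only — long-range order of the two-point function `ω(Δ_x† Δ_y)` in a symmetric translation-invariant state is NOT excluded by this entry (that is the content of the finite-volume entries `PositiveTemperatureNoPairLRO`, `HohenbergMerminWagnerPairing`, for Gibbs states on tori); finite `β` only (every `β ≥ 0`; `β = 0` included trivially); the interaction class formalised is exactly `gcInteractionTT' t t' U μ h` (nearest- and next-nearest-neighbour hopping, on-site `U` of either sign, chemical potential, Zeeman field along `z`) — general finite-range charge-conserving even interactions on `ℤ²` are covered by the model-independent theorem `IsVarEquilibrium.expect_eq_zero_of_conservedCharge_two` but no other named model is instantiated; the spin statement (2) of the Prop concerns rotations about the `z` axis (the charge `n↑ − n↓`, any `h`); the full `SU(2)` statement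 `ω(S^z_x) = 0`, `ω(n_{x↑} − n_{x↓}) = 0`, staggered magnetisation `= 0` holds at `h = 0` ONLY (the Zeeman term breaks the spin flip) and is instantiated in `HubbardPeriodicEquilibriumStatesNoMagneticOrder` (spin-flip charge `S⁺ + S⁻`); no rate or finite-volume remnant is asserted (the statement is `ω(O) = 0` exactly, in infinite volume).
status: established (theorem; PROVED in the tree: `Literature.MathematicalPhysics.QuantumLattice.InfVolFermionState.IsVarEquilibrium.expect_eq_zero_of_numberCharged_ttPrime`, `…_of_spinCharged_ttPrime`, `…expect_annihilation_mul_annihilation_eq_zero_ttPrime`, assembled below) [cite: KleinLandauShucker1981] [cite: ArakiMoriya2003, Theorem 12.11]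
-/

noncomputable section

open scoped ComplexOrder Matrix.Norms.L2Operator

namespace Literature.Barriers.HubbardSuperconductivity

open Literature.MathematicalPhysics.QuantumLattice Literature.Probability.LatticeModels

/-- **Barrier `EquilibriumStatesNoU1Breaking2D`** (Klein–Landau–Shucker / Koma–Tasaki, infinite volume): in every translation-invariant
equilibrium state of the 2D `t–t'` Hubbard model at any `β ≥ 0`, every local observable of nonzero particle number and every local
observable of nonzero spin imbalance has zero expectation; in particular every pair amplitude `ω(c_p c_q)` vanishes.
[cite: KleinLandauShucker1981] [cite: KomaTasakiPRL1992, p. 3] [cite: ArakiMoriya2003, Theorem 12.11] -/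
def EquilibriumStatesNoU1Breaking2D : Prop :=
  ∀ (t t' U μ hz β : ℝ), 0 ≤ β → ∀ ω : InfVolFermionState 2, ω.IsVarEquilibrium β (gcInteractionTT' t t' U μ hz) 1 →
    (∀ (Λ : Finset (Site 2)) (O : FermionOp Λ) (κ : ℂ), κ ≠ 0 →
        (totalNumber : FermionOp Λ) * O - O * totalNumber = κ • O → ω.expect Λ O = 0) ∧
      (∀ (Λ : Finset (Site 2)) (O : FermionOp Λ) (κ : ℂ), κ ≠ 0 →
        (spinImbalance : FermionOp Λ) * O - O * spinImbalance = κ • O → ω.expect Λ O = 0) ∧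
      ∀ (Λ : Finset (Site 2)) (p q : Orb (PolySite Λ)), ω.expect Λ (annihilation p * annihilation q) = 0

/-- **The barrier is a theorem.** [cite: KleinLandauShucker1981] [cite: ArakiMoriya2003, Theorem 12.11] -/
theorem EquilibriumStatesNoU1Breaking2D_holds : EquilibriumStatesNoU1Breaking2D :=
  fun t t' U μ hz _β hβ _ω h =>
    ⟨fun _Λ O _κ hκ hO => h.expect_eq_zero_of_numberCharged_ttPrime t t' U μ hz hβ O hκ hO,
      fun _Λ O _κ hκ hO => h.expect_eq_zero_of_spinCharged_ttPrime t t' U μ hz hβ O hκ hO,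
      fun _Λ p q => h.expect_annihilation_mul_annihilation_eq_zero_ttPrime t t' U μ hz hβ p q⟩

/-- **For users: no pairing amplitude in any translation-invariant equilibrium state of the 2D `t–t'` Hubbard model, at any temperature.**
[cite: KleinLandauShucker1981] [cite: KomaTasakiPRL1992, p. 3] -/
theorem EquilibriumStatesNoU1Breaking2D.pairAmplitude_eq_zero {t t' U μ hz β : ℝ} (hβ : 0 ≤ β) {ω : InfVolFermionState 2}
    (h : ω.IsVarEquilibrium β (gcInteractionTT' t t' U μ hz) 1) {Λ : Finset (Site 2)} (p q : Orb (PolySite Λ)) :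
    ω.expect Λ (annihilation p * annihilation q) = 0 :=
  (EquilibriumStatesNoU1Breaking2D_holds t t' U μ hz β hβ ω h).2.2 Λ p q

/-- **v2, periodic states: no pairing amplitude of ANY PERIOD** — `ω(c_p c_q) = 0` in every `q`-periodic equilibrium state
(`IsPerVarEquilibrium`, any period `q`) of the 2D `t–t'` Hubbard model at any `β ≥ 0`: a pair-density wave is excluded exactly like the
uniform condensate. [cite: KleinLandauShucker1981] [cite: KomaTasakiPRL1992, p. 3] -/
theorem EquilibriumStatesNoU1Breaking2D.periodic_pairAmplitude_eq_zero {t t' U μ hz β : ℝ} (hβ : 0 ≤ β) {q : Fin 2 → ℕ}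
    {ω : InfVolFermionState 2} (h : ω.IsPerVarEquilibrium β q (gcInteractionTT' t t' U μ hz) 1) {Λ : Finset (Site 2)}
    (p p' : Orb (PolySite Λ)) : ω.expect Λ (annihilation p * annihilation p') = 0 :=
  h.expect_annihilation_mul_annihilation_eq_zero_ttPrime t t' U μ hz hβ p p'

/-- **v2, `SU(2)` at zero field: no magnetisation at any site** — `ω(S^z_x) = 0` in every `q`-periodic equilibrium state of the
zero-field 2D `t–t'` Hubbard model at any `β ≥ 0` (no ferro-, antiferro-, ferrimagnetic, spiral or stripe one-point order of any period).
[cite: Ghosh1971] [cite: KleinLandauShucker1981] -/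
theorem EquilibriumStatesNoU1Breaking2D.periodic_sZ_eq_zero {t t' U μ β : ℝ} (hβ : 0 ≤ β) {q : Fin 2 → ℕ}
    {ω : InfVolFermionState 2} (h : ω.IsPerVarEquilibrium β q (gcInteractionTT' t t' U μ 0) 1) {Λ : Finset (Site 2)} {x : Site 2}
    (hx : x ∈ Λ) : ω.expect Λ (sZAt x hx) = 0 :=
  h.expect_sZAt_eq_zero_ttPrime t t' U μ hβ hx

/-- **v2: the staggered magnetisation of every periodic equilibrium state of the zero-field 2D `t–t'` Hubbard model vanishes** (no Néel
order parameter at any `T > 0` in `d = 2`). [cite: Ghosh1971] [cite: KomaTasakiPRL1992, p. 3] -/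
theorem EquilibriumStatesNoU1Breaking2D.periodic_staggeredMagnetisation_eq_zero {t t' U μ β : ℝ} (hβ : 0 ≤ β) {q : Fin 2 → ℕ}
    {ω : InfVolFermionState 2} (h : ω.IsPerVarEquilibrium β q (gcInteractionTT' t t' U μ 0) 1) : ω.staggeredMagnetisation = 0 :=
  h.staggeredMagnetisation_eq_zero_ttPrime t t' U μ hβ

end Literature.Barriers.HubbardSuperconductivity

end
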